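import Summits.CriticalPhenomena.PercolationContinuityZ3.Theorems.PercNearOneGluingNoHeavyLowerTailSahiTwoLevelC3

/-!
# The two-level forms of Sahi's `E_3`: the third-central-moment decomposition, the slack `r₂`,
# the proved case `κ₃(G) ≥ 0`, and the sharpened conjecture PLUS′

Support file of the one-cut programme (crux `NoHeavyLowerTail`, stmt-CriticalPhenomena-4575; cell `prim-bnk`, seat bnk-2 gen 9,
memo `run/shared/lean/prim/prim-l12/FROM-prim-bnk-2-g9-TWO-LEVEL-STRUCTURE.md`; INEQ-CLAIMS rows COMB-M-E3 / S2-GRAPH / PLUS′).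

Recall (`…SahiTwoLevelC3`): for a nested pair `H_i ⊆ G_i` (`i = 0,1,2`) of triples of increasing events the TOP two-level form is
`T⁺(G,H) := twoLevelForm P G H − ∏_i (P(G_i) − P(H_i))` (`SahiTwoLevelPlus`: `T⁺ ≥ 0`, the measure-level shadow of the comb law
`c_3 ≤ c_2`; it implies Sahi's `C_3` on product measures, `kahnConjecture_of_sahiTwoLevelPlus`).  This file records the EXACT
STRUCTURE of `T⁺` found in gen 9 (all identities are `ring` identities in the moments; the inequalities use only Harris'
inequality and the additivity of the measure):

* `twoLevelForm_sub_prod_eq` — **`T⁺(G,H) = κ₃(G) + Σ_k (P(G_k) − P(H_k))·Cov(G_i,G_j) + Σ_k Cov(H_i ∩ H_j, G_k) + r₂(G,H)`**, where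
  `κ₃(G) = P(G₀G₁G₂) − Σ_k P(G_k)P(G_iG_j) + 2P(G₀)P(G₁)P(G₂)` is the third central mixed moment `E[∏_k (1_{G_k} − P(G_k))]`
  (`thirdCentralMoment`) and `r₂ = P(G₀G₁G₂) − Σ_k P(H_iH_jG_k) + 2P(H₀H₁H₂)` (`twoLevelSlack`) is, for a measure and a nested
  pair, the probability of `G₀ ∩ G₁ ∩ G₂ ∩ {at most one of the H_a}` (`twoLevelSlack_nonneg`).  (For comparison, Sahi's functional
  itself is `2E_3(G) = κ₃(G) + Σ_k Cov(G_i ∩ G_j, G_k)`, `two_mul_sahiE3_eq`.)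
* **THEOREM `twoLevelForm_sub_prod_ge_thirdCentralMoment`: `T⁺(G,H) ≥ κ₃(G)`** for every nested pair of triples of increasing
  events under every product measure on a finite cube (Harris twice + `r₂ ≥ 0`); hence **`SahiTwoLevelPlus` and `SahiTwoLevelMinus`
  hold at every pair whose top triple has `κ₃(G) ≥ 0`** (`twoLevelPlus_nonneg_of_thirdCentralMoment_nonneg`,
  `twoLevelForm_nonneg_of_thirdCentralMoment_nonneg`) — the two-level laws are nontrivial only in the regime of a NEGATIVE third
  central moment of the top triple (e.g. `G₀ = G₁ = G₂ = X` with `P(X) > 1/2`).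
* **CONJECTURE PLUS′** (`SahiTwoLevelPlusPrime`, new, OPEN): `T⁺(G,H) − r₂(G,H) = κ₃(G) + Σ_k δ_k Cov(G_i,G_j) + Σ_k Cov(H_iH_j,G_k) ≥ 0`
  (`twoLevelPlusPrime_eq`); at `H = G` it is `2E_3(G) ≥ 0`, at `H = ∅` it is `P(G₀G₁G₂) ≥ ∏P(G_i)`; it implies `SahiTwoLevelPlus`
  (`sahiTwoLevelPlus_of_plusPrime`) hence Kahn's Conjecture 5 (`kahnConjecture_of_sahiTwoLevelPlusPrime`).  Census (bnk-2 gen 9, two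
  implementations — C `plus2.c`/`atower.c` and python `twolevel.py`/`comb_plusprime.py`): measure level — ALL nested pairs of up-set
  triples of `{0,1}^3` × the `9^3` grid of `q` + 30 random `q` (3.6·10⁹ evaluations, minimum exactly `0`), random nested pairs on `≤ 5`
  coordinates, and 1 500 random ferromagnetic Ising (FKG) measures on `{0,1}^4` with exhaustive alternating minimisation over `H`
  (3.3·10⁸ evaluations): `0` violations; COEFFICIENTWISE (tensor-Bernstein / three-copy comb) version `c_2(k) − c_3(k) ≥ ρ_e(k)`
  (`ρ_e` = three-copy lift of `r₂`): ALL 804 440 unordered triples of up-sets of `{0,1}^4` × 4 axes = 2.06·10⁸ cells, exhaustive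
  `m = 3`, random `m = 5, 6`: `0` violations (17 608 / 384 000 tight cells at `m = 5`).  NOT claimed: PLUS′, `SahiTwoLevelPlus`, `C_3`
  remain OPEN.  Also recorded in the memo: no degree-3 'instance-blind' certificate of `T⁺ ≥ 0` from {Harris on all 980 grid up-sets of
  the level algebra, `E_3 ≥ 0` on all its triples, positivity} exists (cone LP with full pricing, kit j111308). [this work]
-/

noncomputable section

open scoped Classical

namespace Summit.CriticalPhenomena.PercolationContinuityZ3.Theorems

open Finset Function MeasureTheory
open Literature.Combinatorics.Sahi2008
open Literature.Probability.LatticeModels (prodBernoulli prodBernoulli_harris)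
open Literature.Probability.Percolation.DecisionTree (ind ind_of_mem ind_of_not_mem ind_nonneg)

/-! ### The algebra: third central moment, slack, and the decomposition of the TOP form -/

section Algebra

variable {κ : Type*}

/-- **Third central mixed moment of a triple of events** under a set function `P`:
`κ₃(G) = P(G₀G₁G₂) − Σ_k P(G_k)P(G_iG_j) + 2P(G₀)P(G₁)P(G₂)` (`= E[∏_k (1_{G_k} − P(G_k))]` for a probability measure). [this work] -/
def thirdCentralMoment (P : Set (Set κ) → ℝ) (G : Fin 3 → Set (Set κ)) : ℝ :=
  P (G 0 ∩ G 1 ∩ G 2)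
    - (P (G 0) * P (G 1 ∩ G 2) + P (G 1) * P (G 0 ∩ G 2) + P (G 2) * P (G 0 ∩ G 1))
    + 2 * (P (G 0) * P (G 1) * P (G 2))

/-- **The slack `r₂(G,H)` of the TOP two-level form**: `P(G₀G₁G₂) − Σ_k P(H_iH_jG_k) + 2P(H₀H₁H₂)`; for a measure and a nested pair
`H_i ⊆ G_i` this is `P(G₀ ∩ G₁ ∩ G₂ ∩ {at most one of H₀,H₁,H₂})` (inclusion–exclusion), hence `≥ 0` (`twoLevelSlack_nonneg`). [this work] -/
def twoLevelSlack (P : Set (Set κ) → ℝ) (G H : Fin 3 → Set (Set κ)) : ℝ :=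
  P (G 0 ∩ G 1 ∩ G 2)
    - (P (H 1 ∩ H 2 ∩ G 0) + P (H 0 ∩ H 2 ∩ G 1) + P (H 0 ∩ H 1 ∩ G 2))
    + 2 * P (H 0 ∩ H 1 ∩ H 2)

/-- **The decomposition of the TOP two-level form** (ring identity in the moments, any set function `P`):
`twoLevelForm P G H − ∏_i (P(G_i) − P(H_i)) = κ₃(G) + Σ_k (P(G_k) − P(H_k))·(P(G_iG_j) − P(G_i)P(G_j))
  + Σ_k (P(H_iH_jG_k) − P(H_iH_j)P(G_k)) + r₂(G,H)`. [this work] -/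
theorem twoLevelForm_sub_prod_eq (P : Set (Set κ) → ℝ) (G H : Fin 3 → Set (Set κ)) :
    twoLevelForm P G H - ∏ i, (P (G i) - P (H i)) =
      thirdCentralMoment P G
      + ((P (G 0) - P (H 0)) * (P (G 1 ∩ G 2) - P (G 1) * P (G 2))
        + (P (G 1) - P (H 1)) * (P (G 0 ∩ G 2) - P (G 0) * P (G 2))
        + (P (G 2) - P (H 2)) * (P (G 0 ∩ G 1) - P (G 0) * P (G 1)))
      + ((P (H 1 ∩ H 2 ∩ G 0) - P (H 1 ∩ H 2) * P (G 0))
        + (P (H 0 ∩ H 2 ∩ G 1) - P (H 0 ∩ H 2) * P (G 1))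
        + (P (H 0 ∩ H 1 ∩ G 2) - P (H 0 ∩ H 1) * P (G 2)))
      + twoLevelSlack P G H := by
  simp only [twoLevelForm, thirdCentralMoment, twoLevelSlack, Fin.prod_univ_three]
  ring

/-- **PLUS′ in closed form**: `twoLevelForm P G H − ∏_i (P(G_i) − P(H_i)) − r₂(G,H) = κ₃(G) + Σ_k δ_k Cov(G_i,G_j) + Σ_k Cov(H_iH_j, G_k)`
(ring identity). [this work] -/
theorem twoLevelPlusPrime_eq (P : Set (Set κ) → ℝ) (G H : Fin 3 → Set (Set κ)) :
    twoLevelForm P G H - ∏ i, (P (G i) - P (H i)) - twoLevelSlack P G H =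
      thirdCentralMoment P G
      + ((P (G 0) - P (H 0)) * (P (G 1 ∩ G 2) - P (G 1) * P (G 2))
        + (P (G 1) - P (H 1)) * (P (G 0 ∩ G 2) - P (G 0) * P (G 2))
        + (P (G 2) - P (H 2)) * (P (G 0 ∩ G 1) - P (G 0) * P (G 1)))
      + ((P (H 1 ∩ H 2 ∩ G 0) - P (H 1 ∩ H 2) * P (G 0))
        + (P (H 0 ∩ H 2 ∩ G 1) - P (H 0 ∩ H 2) * P (G 1))
        + (P (H 0 ∩ H 1 ∩ G 2) - P (H 0 ∩ H 1) * P (G 2))) := by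
  rw [twoLevelForm_sub_prod_eq]
  ring

/-- **Sahi's functional in the same language**: `2·E_3(G) = κ₃(G) + Σ_k Cov(G_i ∩ G_j, G_k)`, written with the single triple
moment `P(G₀G₁G₂)` (ring identity; `E_3 = 2P(G₀G₁G₂) + ∏P(G_i) − Σ_k P(G_k)P(G_iG_j)`). [this work] -/
theorem two_mul_sahiE3_moments_eq (P : Set (Set κ) → ℝ) (G : Fin 3 → Set (Set κ)) :
    2 * (2 * P (G 0 ∩ G 1 ∩ G 2) + P (G 0) * P (G 1) * P (G 2)
          - (P (G 0) * P (G 1 ∩ G 2) + P (G 1) * P (G 0 ∩ G 2) + P (G 2) * P (G 0 ∩ G 1))) =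
      thirdCentralMoment P G
      + ((P (G 0 ∩ G 1 ∩ G 2) - P (G 1 ∩ G 2) * P (G 0)) + (P (G 0 ∩ G 1 ∩ G 2) - P (G 0 ∩ G 2) * P (G 1))
        + (P (G 0 ∩ G 1 ∩ G 2) - P (G 0 ∩ G 1) * P (G 2))) := by
  simp only [thirdCentralMoment]
  ring

/-- At the diagonal `H = G` the slack vanishes and the TOP form is `2·E_3(G)` in moment form (ring identity). [this work] -/
theorem twoLevelForm_self_sub_prod_eq (P : Set (Set κ) → ℝ) (G : Fin 3 → Set (Set κ)) :
    twoLevelForm P G G - ∏ i, (P (G i) - P (G i)) =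
      2 * (2 * P (G 0 ∩ G 1 ∩ G 2) + P (G 0) * P (G 1) * P (G 2)
          - (P (G 0) * P (G 1 ∩ G 2) + P (G 1) * P (G 0 ∩ G 2) + P (G 2) * P (G 0 ∩ G 1))) := by
  simp only [twoLevelForm, Fin.prod_univ_three]
  ring

end Algebra

/-! ### The measure facts: `r₂ ≥ 0`, Harris, and `T⁺ ≥ κ₃(G)` -/

section Measure

variable {κ : Type} [Fintype κ]

omit [Fintype κ] in
/-- For a nested pair, `H_i ∩ H_j ∩ G_k = (G₀ ∩ G₁ ∩ G₂) ∩ (H_i ∩ H_j)`. [folklore] -/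
theorem inter_inter_eq_triple_inter {G H : Fin 3 → Set (Set κ)} (hHG : ∀ i, H i ⊆ G i) (i j k : Fin 3)
    (hijk : ({i, j, k} : Finset (Fin 3)) = Finset.univ) :
    H i ∩ H j ∩ G k = (G 0 ∩ G 1 ∩ G 2) ∩ (H i ∩ H j) := by
  ext ω
  simp only [Set.mem_inter_iff]
  constructor
  · rintro ⟨⟨hi, hj⟩, gk⟩
    have hG : ∀ l ∈ ({i, j, k} : Finset (Fin 3)), ω ∈ G l := by
      intro l hl
      simp only [Finset.mem_insert, Finset.mem_singleton] at hl
      rcases hl with rfl | rfl | rfl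
      · exact hHG _ hi
      · exact hHG _ hj
      · exact gk
    rw [hijk] at hG
    exact ⟨⟨⟨hG 0 (Finset.mem_univ _), hG 1 (Finset.mem_univ _)⟩, hG 2 (Finset.mem_univ _)⟩, hi, hj⟩
  · rintro ⟨⟨⟨g0, g1⟩, g2⟩, hi, hj⟩
    refine ⟨⟨hi, hj⟩, ?_⟩
    fin_cases k
    · exact g0
    · exact g1
    · exact g2

omit [Fintype κ] in
/-- For a nested pair, `H₀ ∩ H₁ ∩ H₂ = (G₀ ∩ G₁ ∩ G₂) ∩ (H₀ ∩ H₁ ∩ H₂)`. [folklore] -/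
theorem triple_inter_eq_inter_triple {G H : Fin 3 → Set (Set κ)} (hHG : ∀ i, H i ⊆ G i) :
    H 0 ∩ H 1 ∩ H 2 = (G 0 ∩ G 1 ∩ G 2) ∩ (H 0 ∩ H 1 ∩ H 2) := by
  ext ω
  simp only [Set.mem_inter_iff]
  constructor
  · rintro ⟨⟨h0, h1⟩, h2⟩
    exact ⟨⟨⟨hHG 0 h0, hHG 1 h1⟩, hHG 2 h2⟩, ⟨h0, h1⟩, h2⟩
  · rintro ⟨-, h⟩
    exact h

omit [Fintype κ] in
/-- **The pointwise inclusion–exclusion behind `r₂`**: for `t, b₀, b₁, b₂ ∈ {0,1}` (indicators),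
`t − t(b₁b₂ + b₀b₂ + b₀b₁) + 2t·b₀b₁b₂ ≥ 0` (it is `t·1[at most one b_a = 1]`). [folklore] -/
theorem incl_excl_pointwise (T A B C : Set (Set κ)) (ω : Set κ) :
    0 ≤ ind T ω - (ind T ω * (ind B ω * ind C ω) + ind T ω * (ind A ω * ind C ω) + ind T ω * (ind A ω * ind B ω))
      + 2 * (ind T ω * (ind A ω * ind B ω * ind C ω)) := by
  by_cases hT : ω ∈ T <;> by_cases hA : ω ∈ A <;> by_cases hB : ω ∈ B <;> by_cases hC : ω ∈ C <;>
    norm_num [ind_of_mem, ind_of_not_mem, hT, hA, hB, hC]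

omit [Fintype κ] in
/-- `1_{X ∩ Y} = 1_X · 1_Y` pointwise. [folklore] -/
theorem ind_inter_mul (X Y : Set (Set κ)) (ω : Set κ) : ind (X ∩ Y) ω = ind X ω * ind Y ω :=
  Literature.Probability.Percolation.BHK2006.ind_inter X Y ω

/-- **`r₂ ≥ 0`**: for a nested pair of triples under a product measure the slack is the probability of
`G₀G₁G₂ ∩ {at most one H_a}`, in particular nonnegative. [this work] -/
theorem twoLevelSlack_nonneg (q : κ → unitInterval) (G H : Fin 3 → Set (Set κ)) (hHG : ∀ i, H i ⊆ G i) :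
    0 ≤ twoLevelSlack (fun A => (prodBernoulli q).real A) G H := by
  have e0 : H 1 ∩ H 2 ∩ G 0 = (G 0 ∩ G 1 ∩ G 2) ∩ (H 1 ∩ H 2) := inter_inter_eq_triple_inter hHG 1 2 0 (by decide)
  have e1 : H 0 ∩ H 2 ∩ G 1 = (G 0 ∩ G 1 ∩ G 2) ∩ (H 0 ∩ H 2) := inter_inter_eq_triple_inter hHG 0 2 1 (by decide)
  have e2 : H 0 ∩ H 1 ∩ G 2 = (G 0 ∩ G 1 ∩ G 2) ∩ (H 0 ∩ H 1) := inter_inter_eq_triple_inter hHG 0 1 2 (by decide)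
  have e3 : H 0 ∩ H 1 ∩ H 2 = (G 0 ∩ G 1 ∩ G 2) ∩ (H 0 ∩ H 1 ∩ H 2) := triple_inter_eq_inter_triple hHG
  simp only [twoLevelSlack]
  rw [e0, e1, e2, e3]
  simp only [← ex_bernoulliWeight_ind]
  set T := G 0 ∩ G 1 ∩ G 2 with hT
  have hpt : ∀ ω, 0 ≤ ind (T ∩ (H 1 ∩ H 2)) ω * 0 + (ind T ω
      - (ind (T ∩ (H 1 ∩ H 2)) ω + ind (T ∩ (H 0 ∩ H 2)) ω + ind (T ∩ (H 0 ∩ H 1)) ω)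
      + 2 * ind (T ∩ (H 0 ∩ H 1 ∩ H 2)) ω) := by
    intro ω
    simp only [ind_inter_mul, mul_zero, zero_add]
    exact incl_excl_pointwise T (H 0) (H 1) (H 2) ω
  have hsum : ex (bernoulliWeight q) (ind T)
      - (ex (bernoulliWeight q) (ind (T ∩ (H 1 ∩ H 2))) + ex (bernoulliWeight q) (ind (T ∩ (H 0 ∩ H 2)))
          + ex (bernoulliWeight q) (ind (T ∩ (H 0 ∩ H 1))))
      + 2 * ex (bernoulliWeight q) (ind (T ∩ (H 0 ∩ H 1 ∩ H 2))) =
      ex (bernoulliWeight q) (fun ω => ind T ω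
        - (ind (T ∩ (H 1 ∩ H 2)) ω + ind (T ∩ (H 0 ∩ H 2)) ω + ind (T ∩ (H 0 ∩ H 1)) ω)
        + 2 * ind (T ∩ (H 0 ∩ H 1 ∩ H 2)) ω) := by
    simp only [ex, ← Finset.sum_sub_distrib, ← Finset.sum_add_distrib, Finset.mul_sum]
    exact Finset.sum_congr rfl fun ω _ => by ring
  rw [hsum]
  refine ex_nonneg (isFKGMeasure_bernoulliWeight q).nonneg fun ω => ?_
  have h := hpt ω
  simpa using h

/-- **THEOREM: the TOP two-level form dominates the third central moment of the top triple.**  For every product measure on a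
finite cube and every nested pair `H_i ⊆ G_i` of triples of increasing events,
`twoLevelForm μ G H − ∏_i (μ(G_i) − μ(H_i)) ≥ κ₃(G)` (Harris for `(G_i,G_j)` and `(H_i ∩ H_j, G_k)`, monotonicity of `μ`, and `r₂ ≥ 0`).
[this work] -/
theorem twoLevelForm_sub_prod_ge_thirdCentralMoment (q : κ → unitInterval) (G H : Fin 3 → Set (Set κ))
    (hG : ∀ i, IsUpperSet (G i)) (hH : ∀ i, IsUpperSet (H i)) (hHG : ∀ i, H i ⊆ G i) :
    thirdCentralMoment (fun A => (prodBernoulli q).real A) G ≤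
      twoLevelForm (fun A => (prodBernoulli q).real A) G H
        - ∏ i, ((prodBernoulli q).real (G i) - (prodBernoulli q).real (H i)) := by
  rw [twoLevelForm_sub_prod_eq]
  have hδ : ∀ i, 0 ≤ (prodBernoulli q).real (G i) - (prodBernoulli q).real (H i) :=
    fun i => sub_nonneg.2 (measureReal_mono (hHG i))
  have hcov : ∀ i j, 0 ≤ (prodBernoulli q).real (G i ∩ G j) - (prodBernoulli q).real (G i) * (prodBernoulli q).real (G j) :=
    fun i j => sub_nonneg.2 (prodBernoulli_harris q (hG i) (hG j) MeasurableSet.of_discrete MeasurableSet.of_discrete)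
  have hcov2 : ∀ i j k, 0 ≤ (prodBernoulli q).real (H i ∩ H j ∩ G k)
      - (prodBernoulli q).real (H i ∩ H j) * (prodBernoulli q).real (G k) :=
    fun i j k => sub_nonneg.2 (prodBernoulli_harris q ((hH i).inter (hH j)) (hG k)
      MeasurableSet.of_discrete MeasurableSet.of_discrete)
  have hr := twoLevelSlack_nonneg q G H hHG
  nlinarith [mul_nonneg (hδ 0) (hcov 1 2), mul_nonneg (hδ 1) (hcov 0 2), mul_nonneg (hδ 2) (hcov 0 1),
    hcov2 1 2 0, hcov2 0 2 1, hcov2 0 1 2]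

/-- **`SahiTwoLevelPlus` holds at every nested pair whose top triple has nonnegative third central moment.** [this work] -/
theorem twoLevelPlus_nonneg_of_thirdCentralMoment_nonneg (q : κ → unitInterval) (G H : Fin 3 → Set (Set κ))
    (hG : ∀ i, IsUpperSet (G i)) (hH : ∀ i, IsUpperSet (H i)) (hHG : ∀ i, H i ⊆ G i)
    (hκ : 0 ≤ thirdCentralMoment (fun A => (prodBernoulli q).real A) G) :
    0 ≤ twoLevelForm (fun A => (prodBernoulli q).real A) G H
        - ∏ i, ((prodBernoulli q).real (G i) - (prodBernoulli q).real (H i)) :=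
  le_trans hκ (twoLevelForm_sub_prod_ge_thirdCentralMoment q G H hG hH hHG)

/-- **`SahiTwoLevelMinus` (the bottom form `twoLevelForm ≥ 0`) at every nested pair with `κ₃(G) ≥ 0`.** [this work] -/
theorem twoLevelForm_nonneg_of_thirdCentralMoment_nonneg (q : κ → unitInterval) (G H : Fin 3 → Set (Set κ))
    (hG : ∀ i, IsUpperSet (G i)) (hH : ∀ i, IsUpperSet (H i)) (hHG : ∀ i, H i ⊆ G i)
    (hκ : 0 ≤ thirdCentralMoment (fun A => (prodBernoulli q).real A) G) :
    0 ≤ twoLevelForm (fun A => (prodBernoulli q).real A) G H := by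
  have hprod : 0 ≤ ∏ i, ((prodBernoulli q).real (G i) - (prodBernoulli q).real (H i)) :=
    prod_nonneg fun i _ => sub_nonneg.2 (measureReal_mono (hHG i))
  linarith [twoLevelPlus_nonneg_of_thirdCentralMoment_nonneg q G H hG hH hHG hκ]

end Measure

/-! ### The sharpened conjecture PLUS′ and its place in the ladder -/

/-- **Conjecture PLUS′** (bnk-2 gen 9; the TOP two-level form with its slack removed):
for every finite cube, every product measure `μ_q` and all nested triples `H_i ⊆ G_i` of increasing events,
`0 ≤ twoLevelForm μ G H − ∏_i (μ(G_i) − μ(H_i)) − r₂(G,H)`, i.e. (`twoLevelPlusPrime_eq`)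
`κ₃(G) + Σ_k (μ(G_k) − μ(H_k))·Cov(G_i,G_j) + Σ_k Cov(H_i ∩ H_j, G_k) ≥ 0`.
At `H = G`: `2E_3(G) ≥ 0` (Sahi `C_3`); at `H = ∅`: `μ(G₀G₁G₂) ≥ ∏ μ(G_i)`; trivial when `κ₃(G) ≥ 0`; proved when the `G_k` have
pairwise disjoint supports (memo §2).  Stronger than `SahiTwoLevelPlus` (`sahiTwoLevelPlus_of_plusPrime`).  Census (gen 9, two engines):
all nested pairs on `{0,1}^3` × `9^3`-grid + random `q` (3.6·10⁹ evaluations, min exactly `0`); random pairs on `≤ 5` coordinates;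
1 500 random ferromagnetic Ising (FKG) measures on `{0,1}^4` with exhaustive alternating minimisation over `H` (3.3·10⁸ evaluations);
coefficientwise (three-copy comb) version `c_2 − c_3 ≥ ρ_e` exhaustive on `{0,1}^3`, `{0,1}^4` (2.06·10⁸ cells) and random on `5, 6`
coordinates: `0` violations.  UPDATE (bnk-2 gen 15, memo `…/FROM-prim-bnk-2-g15-COMB-PLUSPRIME-FALLOUT.md`): the COEFFICIENTWISE
version is **FALSE on `{0,1}^5`** (ttrl cp-s2top `PLUSPRIME.md`, exhaustive 912 786 653 440 cells: 7 cells with `c_2 − c_3 − ρ_e = −1` on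
three class triples, e.g. `U = ((x_1∨x_4)(x_2∨x_3), (x_0∨x_4)(x_1∨x_3), x_1(x_0∨x_2))`, axis `x_1`, profile `(1,1,2,2)`: line
`(0,17,20,8)`, `ρ_e = 13`; re-derived by this lane's two engines; `−3` / `−9` on six / seven coins), while THIS measure-level statement
survives every exact attack so far: five coins EXHAUSTIVE with the third member minimised exactly (min cut) at uniform
`q ∈ {1/2,1/3,2/3,1/4,3/4,1/5,4/5,1/6,5/6}` (9 × 7.96·10⁶ (A,B,axis), minimum exactly `0`), p-adversarial refinement, and seeded exact
best response with continuous `p` on `≤ 8` coins at the comb counterexamples' architecture: `0` violations.  The bottom analogue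
`c_1 − c_0 ≥ ρ_e` holds on `{0,1}^5` (exhaustive).  OPEN; an obligation of our theories, never a fact. [this work] [status: open] -/
@[conjecture] def SahiTwoLevelPlusPrime : Prop :=
  ∀ (κ : Type) [Fintype κ] (q : κ → unitInterval) (G H : Fin 3 → Set (Set κ)),
    (∀ i, IsUpperSet (G i)) → (∀ i, IsUpperSet (H i)) → (∀ i, H i ⊆ G i) →
      0 ≤ twoLevelForm (fun A => (prodBernoulli q).real A) G H
            - ∏ i, ((prodBernoulli q).real (G i) - (prodBernoulli q).real (H i))
            - twoLevelSlack (fun A => (prodBernoulli q).real A) G H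

/-- **PLUS′ ⟹ `SahiTwoLevelPlus`** (the slack `r₂` is nonnegative). [this work] -/
theorem sahiTwoLevelPlus_of_plusPrime (h : SahiTwoLevelPlusPrime) : SahiTwoLevelPlus := by
  intro κ _ q G H hG hH hHG
  linarith [h κ q G H hG hH hHG, twoLevelSlack_nonneg q G H hHG]

/-- **PLUS′ ⟹ Sahi's `C_3` on product measures** (`MasterFamilyNonneg 3`). [this work] -/
theorem masterFamilyNonneg_three_of_sahiTwoLevelPlusPrime (h : SahiTwoLevelPlusPrime) : MasterFamilyNonneg 3 :=
  masterFamilyNonneg_three_of_sahiTwoLevelPlus (sahiTwoLevelPlus_of_plusPrime h)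

/-- **PLUS′ ⟹ Kahn's Conjecture 5.** [this work] -/
theorem kahnConjecture_of_sahiTwoLevelPlusPrime (h : SahiTwoLevelPlusPrime) : KahnConjecture :=
  kahnConjecture_of_sahiTwoLevelPlus (sahiTwoLevelPlus_of_plusPrime h)

end Summit.CriticalPhenomena.PercolationContinuityZ3.Theorems
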